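import Summits.CriticalPhenomena.PercolationContinuityZ3.Theorems.Transplant.PlanarSkeletonFrmQuasiDefs
import Summits.CriticalPhenomena.PercolationContinuityZ3.Theorems.Transplant.SkelFrmQuasiBParamsLFA
import Summits.CriticalPhenomena.PercolationContinuityZ3.Theorems.Transplant.SkelFrmBParamsLFA
import Summits.CriticalPhenomena.PercolationContinuityZ3.Theorems.Transplant.SkelNegBParamsRootArithA
import Summits.CriticalPhenomena.PercolationContinuityZ3.Theorems.Transplant.SkelFrmQuasi1ParamsLBL
import Summits.CriticalPhenomena.PercolationContinuityZ3.Theorems.Transplant.SkelFrmQuasi1SlotTypes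
import HarnessLib
import Summits.CriticalPhenomena.PercolationContinuityZ3.Theorems.Transplant.SkelFrmBParamsFaceUnits
/-!
# GEN-Q PORT (WAVE-Q table v0.8 section 2, row G030, U-level L6; captain R-6/R-7 2026-08-27: carrier token swap `PlanarSkeletonFrmFrom ↦ PlanarSkeletonFrmQuasi`)
# of the tree module «Transplant/SkelFrmFromBParamsFaceUnits» (sha256 bfecac935bd91406…) onto the quasi-step carrier `PlanarSkeletonFrmQuasi` (p507026): «SkelFrmQuasiBParamsFaceUnits»

ORIGINAL TITLE: N2 (frames-only node `SamePDropOfSkeletonFrm₁`, OPEN), (F) value layer: **THE FACE UNITS** — the cell-agnostic numbers the face files read from N1's RETIRED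

builds on p205010 (kernel theorem, internal audit signed; external expert review pending) — nothing in this file uses p205010; NOTHING is claimed about any open node
((N3-b), the end state).  Lane `prim-bschramm`, seat `prim-bschramm-stmt` (gen 33; GEN-Q column pen; tool = captain gen-1 g4's port_genq.py R-14 --cone + p3-g30's T1 patch).  Helper file (`--supports stmt-CriticalPhenomena-4575 --as helper`).
PORT RULES (U-wave r1–r4 re-used, GEN-Q hunk classes of p3-g29 #6136): declaration order, names and proof texts are those of «SkelFrmFromBParamsFaceUnits», byte-identical except
(i) the carrier token `PlanarSkeletonFrmFrom ↦ PlanarSkeletonFrmQuasi` in binders, `namespace`/`end` lines and qualified names (module names `SkelFrmFrom… ↦ SkelFrmQuasi…`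
in imports of already-ported rows); (ii) `Φ.step ↦ Φ.qstep` with the called Steps lemma replaced by its `…Q`/`_q` twin and the cost `Φ.M` threaded (none in this file unless
listed below); (iii) `Φ.cyl_connected ↦ Φ.cyl_reach` readers (none unless listed); (iv) graph-ball radii / window floors ×`Φ.M` (none unless listed).  Carrier-free
residents stay imported/exported from the original «SkelFrmBParamsFaceUnits» exactly as in the FrmFrom port.  Docstrings and citations are the original's.

-/

noncomputable section

open scoped Classical

namespace Summit.CriticalPhenomena.PercolationContinuityZ3.Theorems.Transplant

namespace PlanarSkeletonFrmQuasi

namespace NegB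

namespace KS

open Literature.Probability.Percolation Literature.Probability.LatticeModels SimpleGraph
open SkelConc (Consts)
open Skelφ.StepI (DataN)
open TwoAxis.Para (modulus)
open Neg

/-! ## §0 The two functionals (re-homed from N1 part RootVals) -/

/-- **The along functional** `Λ₀(y) := v_β·y₀ − v_L·y₁` (N1 `KS.Λ₀of`, part RootVals :130, cell-free; re-homed here). [this work] -/
def Λ₀of (κ : Consts) {V : Type} [DecidableEq V] [Countable V] {G : SimpleGraph V} [G.LocallyFinite] (Φ : PlanarSkeletonFrmQuasi G) (t : V) (p : unitInterval) (D : Skelφ.StepI.DataNS V) (g : ℕ) (f : ℕ) (y : Site 2) : ℤ :=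
  Skelφ.NegPrm.vβOf (nL κ Φ t p D g f) (hL κ Φ t p D g f) (ℓL κ Φ t p D g f) (vL κ Φ t p D g f) * y 0 - vL κ Φ t p D g f * y 1

/-- **The transverse functional** `Λ₁(y) := n_L·y₁ − h_L·y₀` (N1 `KS.Λ₁of`, part RootVals :133, cell-free; re-homed here). [this work] -/
def Λ₁of (κ : Consts) {V : Type} [DecidableEq V] [Countable V] {G : SimpleGraph V} [G.LocallyFinite] (Φ : PlanarSkeletonFrmQuasi G) (t : V) (p : unitInterval) (D : Skelφ.StepI.DataNS V) (g : ℕ) (f : ℕ) (y : Site 2) : ℤ := (nL κ Φ t p D g f : ℤ) * y 1 - hL κ Φ t p D g f * y 0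

/-! ## §1 The x-run units and origin (N1 part RootVals-A §Origin, minus the target-box conjuncts and the stride count) -/
/-- **The stride unit along axis `0` of the (ζ′) chain: `u₀A := s₀`** (one period = `s₀` cells; `c₀ = A·u₀A`, `r₀ = K·u₀A`). [this work] -/
def u₀A (κ : Consts) {V : Type} [DecidableEq V] [Countable V] {G : SimpleGraph V} [G.LocallyFinite] (Φ : PlanarSkeletonFrmQuasi G) (t : V) (p : unitInterval) (D : Skelφ.StepI.DataNS V) (g : ℕ) (f : ℕ) : ℤ := (((fcellsA κ Φ t p D g f).s 0 : ℕ) : ℤ)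

/-- **The stride unit along axis `1` of the (ζ′) chain: `u₁A := s₁`.** [this work] -/
def u₁A (κ : Consts) {V : Type} [DecidableEq V] [Countable V] {G : SimpleGraph V} [G.LocallyFinite] (Φ : PlanarSkeletonFrmQuasi G) (t : V) (p : unitInterval) (D : Skelφ.StepI.DataNS V) (g : ℕ) (f : ℕ) : ℤ := (((fcellsA κ Φ t p D g f).s 1 : ℕ) : ℤ)

/-- The (ζ′) literals in stride units: `c₀ = A·u₀A`, `c₁ = A·u₁A`, `r₀ = 40Kq·u₀A`, `r₁ = 40Kq·u₁A`, `1 ≤ u₀A`, `1 ≤ u₁A` (N1's two target-box conjuncts are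
RE-HOMED to the K-G window `BSlot.small` and therefore dropped — hp-8 g42 07:10:36Z). [folklore] -/
theorem units_eqA (κ : Consts) {V : Type} [DecidableEq V] [Countable V] {G : SimpleGraph V} [G.LocallyFinite] (Φ : PlanarSkeletonFrmQuasi G) (t : V) (p : unitInterval) (D : Skelφ.StepI.DataNS V) (g : ℕ) (f : ℕ) : 20 * ((fcellsA κ Φ t p D g f).K : ℤ) * (((fcellsA κ Φ t p D g f).s 0 : ℕ) : ℤ) = Aof κ * u₀A κ Φ t p D g f ∧
    20 * ((fcellsA κ Φ t p D g f).K : ℤ) * (((fcellsA κ Φ t p D g f).s 1 : ℕ) : ℤ) = Aof κ * u₁A κ Φ t p D g f ∧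
    ((fcellsA κ Φ t p D g f).r 0 : ℤ) = 40 * (Neg.Kq κ : ℤ) * u₀A κ Φ t p D g f ∧ ((fcellsA κ Φ t p D g f).r 1 : ℤ) = 40 * (Neg.Kq κ : ℤ) * u₁A κ Φ t p D g f ∧
    1 ≤ u₀A κ Φ t p D g f ∧ 1 ≤ u₁A κ Φ t p D g f := by
  have hr := (fcellsA_K κ Φ t p D g f).2.2
  have hs0 : (1 : ℤ) ≤ (((fcellsA κ Φ t p D g f).s 0 : ℕ) : ℤ) := by exact_mod_cast (fcellsA κ Φ t p D g f).hs 0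
  have hs1 : (1 : ℤ) ≤ (((fcellsA κ Φ t p D g f).s 1 : ℕ) : ℤ) := by exact_mod_cast (fcellsA κ Φ t p D g f).hs 1
  unfold u₀A u₁A
  refine ⟨c_eq_A_mul_s κ Φ t p D g f 0, c_eq_A_mul_s κ Φ t p D g f 1, ?_, ?_, hs0, hs1⟩
  · rw [hr 0, Neg.K_eq]; push_cast; ring
  · rw [hr 1, Neg.K_eq]; push_cast; ring

/-- `D_A = A²·m`. [folklore] -/
theorem DofA_eq' (κ : Consts) {V : Type} [DecidableEq V] [Countable V] {G : SimpleGraph V} [G.LocallyFinite] (Φ : PlanarSkeletonFrmQuasi G) (t : V) (p : unitInterval) (D : Skelφ.StepI.DataNS V) (g : ℕ) (f : ℕ) : Skelφ.NegPrm.DofA (Aof κ) (nL κ Φ t p D g f) (hL κ Φ t p D g f) (ℓL κ Φ t p D g f) (vL κ Φ t p D g f) =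
    (Aof κ) ^ 2 * modulus (nL κ Φ t p D g f) (hL κ Φ t p D g f) (vL κ Φ t p D g f) (Skelφ.NegPrm.vβOf (nL κ Φ t p D g f) (hL κ Φ t p D g f) (ℓL κ Φ t p D g f) (vL κ Φ t p D g f)) :=
  Skelφ.NegPrm.DofA_eq _ _ _ _ _

/-- `lam0 A v_L v_β y = A·Λ₀(y)`, `lam1 A n_L h_L y = A·Λ₁(y)`. [folklore] -/
theorem lam_eqA (κ : Consts) {V : Type} [DecidableEq V] [Countable V] {G : SimpleGraph V} [G.LocallyFinite] (Φ : PlanarSkeletonFrmQuasi G) (t : V) (p : unitInterval) (D : Skelφ.StepI.DataNS V) (g : ℕ) (f : ℕ) (y : Site 2) :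
    TwoAxis.Para.lam0 (Aof κ) (vL κ Φ t p D g f) (Skelφ.NegPrm.vβOf (nL κ Φ t p D g f) (hL κ Φ t p D g f) (ℓL κ Φ t p D g f) (vL κ Φ t p D g f)) y = Aof κ * Λ₀of κ Φ t p D g f y ∧
      TwoAxis.Para.lam1 (Aof κ) (nL κ Φ t p D g f : ℤ) (hL κ Φ t p D g f) y = Aof κ * Λ₁of κ Φ t p D g f y := ⟨rfl, rfl⟩

/-- **The run origin's fine abscissa of the (ζ′) chain** `FcA(y) := coarse c₀ (D_A/2) D_A (lam0 A v_L v_β y)` (p3's literal over `prFA`). [this work] -/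
def FcA (κ : Consts) {V : Type} [DecidableEq V] [Countable V] {G : SimpleGraph V} [G.LocallyFinite] (Φ : PlanarSkeletonFrmQuasi G) (t : V) (p : unitInterval) (D : Skelφ.StepI.DataNS V) (g : ℕ) (f : ℕ) (y : Site 2) : ℤ :=
  TwoAxis.Para.coarse (20 * ((fcellsA κ Φ t p D g f).K : ℤ) * (((fcellsA κ Φ t p D g f).s 0 : ℕ) : ℤ))
    (Skelφ.NegPrm.DofA (Aof κ) (nL κ Φ t p D g f) (hL κ Φ t p D g f) (ℓL κ Φ t p D g f) (vL κ Φ t p D g f) / 2)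
    (Skelφ.NegPrm.DofA (Aof κ) (nL κ Φ t p D g f) (hL κ Φ t p D g f) (ℓL κ Φ t p D g f) (vL κ Φ t p D g f))
    (TwoAxis.Para.lam0 (Aof κ) (vL κ Φ t p D g f) (Skelφ.NegPrm.vβOf (nL κ Φ t p D g f) (hL κ Φ t p D g f) (ℓL κ Φ t p D g f) (vL κ Φ t p D g f)) y)

-- GEN-Q (R-2, captain 2026-08-27): `PlanarSkeletonFrmFrom.NegB.KS.FcA_eq_lit` is not in the used cone of the node top — not ported.

/-- **`FcA(y) = (2·u₀A·Λ₀(y) + m)/(2m)`** (`A = 20K` is even and cancels). [folklore] -/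
theorem FcA_eq (κ : Consts) {V : Type} [DecidableEq V] [Countable V] {G : SimpleGraph V} [G.LocallyFinite] (Φ : PlanarSkeletonFrmQuasi G) (t : V) (p : unitInterval) (D : Skelφ.StepI.DataNS V) (g : ℕ) (f : ℕ) (y : Site 2) : FcA κ Φ t p D g f y =
    (2 * u₀A κ Φ t p D g f * Λ₀of κ Φ t p D g f y + modulus (nL κ Φ t p D g f) (hL κ Φ t p D g f) (vL κ Φ t p D g f) (vβL κ Φ t p D g f)) /
      (2 * modulus (nL κ Φ t p D g f) (hL κ Φ t p D g f) (vL κ Φ t p D g f) (vβL κ Φ t p D g f)) := by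
  have hAe : 2 ∣ Aof κ := ⟨10 * (Neg.K κ : ℤ), by rw [Aof_eq_K]; ring⟩
  unfold FcA TwoAxis.Para.coarse
  rw [(units_eqA κ Φ t p D g f).1, DofA_eq', (lam_eqA κ Φ t p D g f y).1]
  exact PlanarSkeletonNeg.NegB.RootArithA.coarse_cancel (Aof_pos κ).1 hAe

/-! ## §2 The y′-origin (N1 part RootVals-YA, minus the stride count) -/
/-- **The y′-origin's fine ordinate of the (ζ′) chain** `F1cA(y) := coarse c₁ (D_A/2) D_A (lam1 A n_L h_L y)` (p3's literal over `prFA`). [this work] -/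
def F1cA (κ : Consts) {V : Type} [DecidableEq V] [Countable V] {G : SimpleGraph V} [G.LocallyFinite] (Φ : PlanarSkeletonFrmQuasi G) (t : V) (p : unitInterval) (D : Skelφ.StepI.DataNS V) (g : ℕ) (f : ℕ) (y : Site 2) : ℤ :=
  TwoAxis.Para.coarse (20 * ((fcellsA κ Φ t p D g f).K : ℤ) * (((fcellsA κ Φ t p D g f).s 1 : ℕ) : ℤ))
    (Skelφ.NegPrm.DofA (Aof κ) (nL κ Φ t p D g f) (hL κ Φ t p D g f) (ℓL κ Φ t p D g f) (vL κ Φ t p D g f) / 2)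
    (Skelφ.NegPrm.DofA (Aof κ) (nL κ Φ t p D g f) (hL κ Φ t p D g f) (ℓL κ Φ t p D g f) (vL κ Φ t p D g f))
    (TwoAxis.Para.lam1 (Aof κ) (nL κ Φ t p D g f : ℤ) (hL κ Φ t p D g f) y)

-- GEN-Q (R-2, captain 2026-08-27): `PlanarSkeletonFrmFrom.NegB.KS.F1cA_eq_lit` is not in the used cone of the node top — not ported.

/-- **`F1cA(y) = (2·u₁A·Λ₁(y) + m)/(2m)`** (`A = 20K` is even and cancels). [folklore] -/
theorem F1cA_eq (κ : Consts) {V : Type} [DecidableEq V] [Countable V] {G : SimpleGraph V} [G.LocallyFinite] (Φ : PlanarSkeletonFrmQuasi G) (t : V) (p : unitInterval) (D : Skelφ.StepI.DataNS V) (g : ℕ) (f : ℕ) (y : Site 2) : F1cA κ Φ t p D g f y =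
    (2 * u₁A κ Φ t p D g f * Λ₁of κ Φ t p D g f y + modulus (nL κ Φ t p D g f) (hL κ Φ t p D g f) (vL κ Φ t p D g f) (vβL κ Φ t p D g f)) /
      (2 * modulus (nL κ Φ t p D g f) (hL κ Φ t p D g f) (vL κ Φ t p D g f) (vβL κ Φ t p D g f)) := by
  have hAe : 2 ∣ Aof κ := ⟨10 * (Neg.K κ : ℤ), by rw [Aof_eq_K]; ring⟩
  unfold F1cA TwoAxis.Para.coarse
  rw [(units_eqA κ Φ t p D g f).2.1, DofA_eq', (lam_eqA κ Φ t p D g f y).2]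
  exact PlanarSkeletonNeg.NegB.RootArithA.coarse_cancel (Aof_pos κ).1 hAe

end KS

end NegB

end PlanarSkeletonFrmQuasi

end Summit.CriticalPhenomena.PercolationContinuityZ3.Theorems.Transplant

end
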